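import Literature.AlgebraicGeometry.HodgeTheory.QuarticQuinticFourfoldHodgeConjectureHolds
import Literature.AlgebraicGeometry.HodgeTheory.CubicFourfoldHodgeConjectureChowZero
import Literature.AlgebraicGeometry.HodgeTheory.HypersurfaceLefschetzUpper
import Literature.AlgebraicGeometry.HodgeTheory.ComplexConjugationHolds
import HarnessLib

/-!
# The Hodge conjecture for smooth hypersurface fourfolds of degree `≤ 5`

Family `hodge`, layer `Literature/AlgebraicGeometry/HodgeTheory`. THEOREMS ONLY (no definition, no named
fact, no hypothesis beyond the printed ones).

For a smooth hypersurface `X ⊂ ℙ⁵_ℂ` of dimension `4` (`Motives.IsSmoothHypersurface 4 d X`) the Hodge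
conjecture `HodgeConjectureFor 4 X` (a Hodge model exists AND every rational `(p,p)`-class of
`H²ᵖ(X(ℂ); ℂ)` is algebraic, every `p`) reduces to its middle slice `p = 2`: the Hodge model is the tree's
theorem `nonempty_hodgeModel_holds` (Serre GAGA + de Rham + Hodge decomposition) and every class of degree
`2p ≠ 4` is algebraic by the Lefschetz theorem on hyperplane sections for smooth hypersurfaces, discharged
in the tree (`Voisin2003_smoothHypersurface_algebraicClasses_eq_top_holds`, Voisin II Cor. 1.24–1.25;
Murre 1977, Remark 1: "It is well-known that the `(1,1)` and `(3,3)`-conjecture are true for any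
fourfold"). The `(2,2)`-slice is Bloch–Srinivas' theorem in degree four (Voisin II Prop. 10.26, the tree's
theorem `BlochSrinivas1983_hodgeConjectureDegreeFour_of_chowZeroSupported_holds`) applied to the
`CH₀`-support of the fourfold on a hyperplane section, which holds for every smooth hypersurface fourfold
of degree `1 ≤ d ≤ 5` (lines through every point for `d ≤ 4`, Roitman's strong lines for `2 ≤ d ≤ 5`;
the tree's `hasChowZeroSupportedInDimLE_three_of_isSmoothHypersurface_four`); degree `0` is vacuous (an
irreducible form has positive degree). Hence:

* `hodgeConjectureFor_four_of_isSmoothHypersurface_of_twoTwo` — `HC(X)` for ONE smooth hypersurface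
  fourfold of ANY degree from its `(2,2)`-slice; `hodgeConjectureFor_four_iff_twoTwo_of_isSmoothHypersurface`;
* `pos_of_isSmoothHypersurface`, `not_isSmoothHypersurface_zero` — degree bookkeeping;
* `mem_algebraicClasses_two_of_isSmoothHypersurface_four_of_le_five` — the `(2,2)`-slice for `d ≤ 5`;
* **`hodgeConjectureFor_of_isSmoothHypersurface_four_of_le_five`** — the Hodge conjecture holds for every
  smooth hypersurface fourfold of degree `d ≤ 5`: `ℙ⁴`-like (`d = 1`), the quadric, the cubic (Zucker 1977,
  Murre 1977), the quartic and the quintic (Conte–Murre 1978) fourfolds; named instances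
  `hodgeConjectureFor_quadricFourfold`, `hodgeConjectureFor_quarticFourfold`,
  `hodgeConjectureFor_quinticFourfold` (the cubic is the tree's `hodgeConjectureFor_cubicFourfold_holds`);
* `forall_hodgeConjectureFor_isSmoothHypersurface_four_iff_six_le`,
  `forall_hodgeConjectureFor_isSmoothHypersurface_four_iff_twoTwo_six_le` — the Hodge conjecture for ALL
  smooth hypersurface fourfolds is equivalent to its degree-`≥ 6` part, indeed to the algebraicity of
  rational `(2,2)`-classes on smooth hypersurface fourfolds of degree `≥ 6` (the honest open residue).

Provenance: Literature home of the Summits-side `Theorems/LimitExtensionHypersurfaceHodgeFourLowDegree`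
(`limitExtension_hypersurfaceHodgeFour_of_twoTwo`, `…_not_isSmoothHypersurface_zero`),
`…LowDegreeProof` (`hypersurfaceHodgeFourLowDegree_proof`) and `…QuarticQuinticHolds`
(`hypersurfaceHodgeFour_iff_six_le`) — route `LimitExtension`, item `HypersurfaceHodgeFourLowDegree`
(stmt-HodgeConjecture-3003), which `Literature/` may not import; the statements below are that item with the
route abbreviation unfolded. Lane `lit-hodgefound`, seat p20.

## References

* [VoisinHodgeII2003] C. Voisin, Hodge Theory and Complex Algebraic Geometry II, §1.2.3 Cor. 1.24–1.25;
  Prop. 10.26 and the remark following it (§10.2.3).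
* [Zucker1977] S. Zucker, The Hodge conjecture for cubic fourfolds, Compositio Math. 34 (1977), (3.2)
  Theorem, p. 206.
* [Murre1977] J. P. Murre, On the Hodge conjecture for unirational fourfolds, Indag. Math. 80 (1977),
  Theorem, Corollary and Remark 1 (p. 230).
* [ConteMurre1978] A. Conte, J. P. Murre, The Hodge conjecture for fourfolds admitting a covering by
  rational curves, Math. Ann. 238 (1978) 79–88.
* [MurreTorino1994] J. P. Murre, Algebraic cycles and algebraic aspects of cohomology and K-theory,
  LNM 1594 (1994), Ch. V §5.3.1.
* [Hartshorne1977] R. Hartshorne, Algebraic Geometry, I Ex. 5.9 and II.8.20.3.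
* [Deligne2000] P. Deligne, The Hodge conjecture (Clay problem description), §1.
-/

noncomputable section

open CategoryTheory AlgebraicGeometry
open Literature.AlgebraicTopology.SingularHomology
open Literature.AlgebraicGeometry.HodgeTheory Literature.AlgebraicGeometry.Motives
  Literature.Barriers.HodgeConjecture Literature.AlgebraicGeometry

namespace Literature.AlgebraicGeometry.HodgeTheory

/-! ### Reduction to the `(2,2)`-slice (one smooth hypersurface fourfold, any degree) -/

/-- **The Hodge conjecture for a smooth hypersurface fourfold reduces to its `(2,2)`-part.** For a
smooth hypersurface `X ⊂ ℙ⁵_ℂ` of dimension `4` (any degree `d`), if every rational `(2,2)`-class of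
`H⁴(X(ℂ); ℂ)` is algebraic then `HodgeConjectureFor 4 X`: the Hodge model is `nonempty_hodgeModel_holds`,
and in every degree `2p ≠ 4` ALL classes are algebraic by the discharged Lefschetz theorem for smooth
hypersurfaces (`Voisin2003_smoothHypersurface_algebraicClasses_eq_top_holds`, assembled with `p = 0`,
`p = 4`, `p > 4` in `Voisin2003_smoothHypersurface_algebraicClasses_eq_top.mem_algebraicClasses`).
[cite: VoisinHodgeII2003, Cor. 1.24 and Cor. 1.25] [cite: Murre1977, Remark 1 (p. 230)] -/
theorem hodgeConjectureFor_four_of_isSmoothHypersurface_of_twoTwo {d : ℕ} {X : SchemeOver ℂ}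
    (hX : IsSmoothHypersurface 4 d X)
    (h22 : ∀ c : complexBetti X (2 * 2), IsRationalClass c → IsOfHodgeType 4 X (2 * 2) 2 2 c →
      c ∈ algebraicClasses X 2) :
    HodgeConjectureFor 4 X := by
  refine ⟨nonempty_hodgeModel_holds hX.1, fun p c hc hpp ↦ ?_⟩
  by_cases hp : p = 2
  · subst hp
    exact h22 c hc hpp
  · exact Voisin2003_smoothHypersurface_algebraicClasses_eq_top_holds.mem_algebraicClasses hX
      (by omega) c

/-- Conversely `HodgeConjectureFor 4 X` contains the `(2,2)`-slice (its `p = 2` component; sanity upper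
bound). [cite: Deligne2000, §1] -/
theorem twoTwo_of_hodgeConjectureFor_four {X : SchemeOver ℂ} (h : HodgeConjectureFor 4 X)
    (c : complexBetti X (2 * 2)) (hc : IsRationalClass c) (hpp : IsOfHodgeType 4 X (2 * 2) 2 2 c) :
    c ∈ algebraicClasses X 2 :=
  h.2 2 c hc hpp

/-- **For a smooth hypersurface fourfold, `HC(X)` is EQUIVALENT to its `(2,2)`-slice.**
[cite: VoisinHodgeII2003, Cor. 1.24 and Cor. 1.25] [cite: Deligne2000, §1] -/
theorem hodgeConjectureFor_four_iff_twoTwo_of_isSmoothHypersurface {d : ℕ} {X : SchemeOver ℂ}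
    (hX : IsSmoothHypersurface 4 d X) :
    HodgeConjectureFor 4 X ↔
      ∀ c : complexBetti X (2 * 2), IsRationalClass c → IsOfHodgeType 4 X (2 * 2) 2 2 c →
        c ∈ algebraicClasses X 2 :=
  ⟨fun h c hc hpp ↦ twoTwo_of_hodgeConjectureFor_four h c hc hpp,
    hodgeConjectureFor_four_of_isSmoothHypersurface_of_twoTwo hX⟩

/-! ### Degree bookkeeping -/

/-- A smooth hypersurface has positive degree: its defining form is irreducible, and an irreducible
homogeneous form has positive degree (`pos_of_irreducible_isHomogeneous`).
[cite: Hartshorne1977, I Ex. 5.9 and II.8.20.3] -/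
theorem pos_of_isSmoothHypersurface {n d : ℕ} {X : SchemeOver ℂ} (hX : IsSmoothHypersurface n d X) :
    0 < d := by
  obtain ⟨-, F, hF, hirr, -⟩ := hX
  exact pos_of_irreducible_isHomogeneous hF hirr

/-- There is no smooth hypersurface of degree `0`. [cite: Hartshorne1977, I Ex. 5.9 and II.8.20.3] -/
theorem not_isSmoothHypersurface_zero {n : ℕ} {X : SchemeOver ℂ} (hX : IsSmoothHypersurface n 0 X) :
    False :=
  (Nat.lt_irrefl 0) (pos_of_isSmoothHypersurface hX)

/-! ### The `(2,2)`-slice in degree `≤ 5` -/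

/-- **Every rational `(2,2)`-class on a smooth hypersurface fourfold of degree `d ≤ 5` is algebraic**:
Bloch–Srinivas' theorem in degree four (Voisin II Prop. 10.26, the tree's theorem
`BlochSrinivas1983_hodgeConjectureDegreeFour_of_chowZeroSupported_holds`) applied to the `CH₀`-support of
the fourfold in dimension `≤ 3` (`hasChowZeroSupportedInDimLE_three_of_isSmoothHypersurface_four`: lines
through every point for `d ≤ 4`, Roitman's strong lines for `2 ≤ d ≤ 5`; `0 < d` by
`pos_of_isSmoothHypersurface`). Covers `ℙ⁴`, the quadric, the cubic (Zucker 1977, Murre 1977), the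
quartic and the quintic (Conte–Murre 1978) fourfolds.
[cite: VoisinHodgeII2003, Prop. 10.26 and the remark following it (§10.2.3)]
[cite: Zucker1977, (3.2) Theorem, p. 206] [cite: ConteMurre1978] [cite: MurreTorino1994, Ch. V §5.3.1] -/
theorem mem_algebraicClasses_two_of_isSmoothHypersurface_four_of_le_five ⦃d : ℕ⦄ ⦃X : SchemeOver ℂ⦄
    (hd : d ≤ 5) (hX : IsSmoothHypersurface 4 d X) (c : complexBetti X (2 * 2))
    (hc : IsRationalClass c) (hpp : IsOfHodgeType 4 X (2 * 2) 2 2 c) : c ∈ algebraicClasses X 2 :=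
  BlochSrinivas1983_hodgeConjectureDegreeFour_of_chowZeroSupported_holds hX.1
    (hasChowZeroSupportedInDimLE_three_of_isSmoothHypersurface_four (pos_of_isSmoothHypersurface hX)
      hd hX) c hc hpp

/-! ### The Hodge conjecture for smooth hypersurface fourfolds of degree `≤ 5` -/

/-- **The Hodge conjecture holds for every smooth hypersurface fourfold `X ⊂ ℙ⁵_ℂ` of degree
`d ≤ 5`** (`ℙ⁴`-like `d = 1`, quadric, cubic — Zucker 1977 / Murre 1977 —, quartic and quintic —
Conte–Murre 1978): the `(2,2)`-slice `mem_algebraicClasses_two_of_isSmoothHypersurface_four_of_le_five`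
fed into the reduction `hodgeConjectureFor_four_of_isSmoothHypersurface_of_twoTwo`. This is the
`LimitExtension` route item `HypersurfaceHodgeFourLowDegree` with its abbreviation unfolded.
[cite: ConteMurre1978] [cite: Zucker1977, (3.2) Theorem, p. 206] [cite: Murre1977, Theorem and Corollary (p. 230)]
[cite: VoisinHodgeII2003, Cor. 1.24–1.25 and Prop. 10.26] -/
theorem hodgeConjectureFor_of_isSmoothHypersurface_four_of_le_five ⦃d : ℕ⦄ ⦃X : SchemeOver ℂ⦄
    (hd : d ≤ 5) (hX : IsSmoothHypersurface 4 d X) : HodgeConjectureFor 4 X :=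
  hodgeConjectureFor_four_of_isSmoothHypersurface_of_twoTwo hX
    (mem_algebraicClasses_two_of_isSmoothHypersurface_four_of_le_five hd hX)

/-- **`HC` for the smooth fourfolds of degree `1` in `ℙ⁵_ℂ`** (hyperplanes, `X ≅ ℙ⁴`).
[cite: VoisinHodgeII2003, Cor. 1.24–1.25 and Prop. 10.26] -/
theorem hodgeConjectureFor_of_isSmoothHypersurface_four_one {X : SchemeOver ℂ}
    (hX : IsSmoothHypersurface 4 1 X) : HodgeConjectureFor 4 X :=
  hodgeConjectureFor_of_isSmoothHypersurface_four_of_le_five (by norm_num) hX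

/-- **`HC` for every smooth quadric fourfold `X ⊂ ℙ⁵_ℂ`.**
[cite: VoisinHodgeII2003, Cor. 1.24–1.25 and Prop. 10.26] [cite: Murre1977, Remark 1 (p. 230)] -/
theorem hodgeConjectureFor_quadricFourfold {X : SchemeOver ℂ} (hX : IsSmoothHypersurface 4 2 X) :
    HodgeConjectureFor 4 X :=
  hodgeConjectureFor_of_isSmoothHypersurface_four_of_le_five (by norm_num) hX

/-- **`HC` for every smooth quartic fourfold `X ⊂ ℙ⁵_ℂ`** (Conte–Murre 1978).
[cite: ConteMurre1978] [cite: MurreTorino1994, Ch. V §5.3.1] -/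
theorem hodgeConjectureFor_quarticFourfold {X : SchemeOver ℂ} (hX : IsSmoothHypersurface 4 4 X) :
    HodgeConjectureFor 4 X :=
  hodgeConjectureFor_of_isSmoothHypersurface_four_of_le_five (by norm_num) hX

/-- **`HC` for every smooth quintic fourfold `X ⊂ ℙ⁵_ℂ`** (Conte–Murre 1978: the quintic fourfold is
Fano, covered by conics). [cite: ConteMurre1978] [cite: MurreTorino1994, Ch. V §5.3.1] -/
theorem hodgeConjectureFor_quinticFourfold {X : SchemeOver ℂ} (hX : IsSmoothHypersurface 4 5 X) :
    HodgeConjectureFor 4 X :=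
  hodgeConjectureFor_of_isSmoothHypersurface_four_of_le_five le_rfl hX

/-! ### The open residue: degrees `≥ 6` -/

/-- **The Hodge conjecture for ALL smooth hypersurface fourfolds is its degree-`≥ 6` part**: it holds
for every smooth hypersurface fourfold iff it holds in every degree `d ≥ 6`, the degrees `d ≤ 5` being
`hodgeConjectureFor_of_isSmoothHypersurface_four_of_le_five`.
[cite: ConteMurre1978] [cite: Zucker1977, (3.2) Theorem, p. 206] -/
theorem forall_hodgeConjectureFor_isSmoothHypersurface_four_iff_six_le :
    (∀ ⦃d : ℕ⦄ ⦃X : SchemeOver ℂ⦄, IsSmoothHypersurface 4 d X → HodgeConjectureFor 4 X) ↔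
      ∀ ⦃d : ℕ⦄ ⦃X : SchemeOver ℂ⦄, 6 ≤ d → IsSmoothHypersurface 4 d X → HodgeConjectureFor 4 X := by
  refine ⟨fun h d X _ hX ↦ h hX, fun h d X hX ↦ ?_⟩
  rcases Nat.lt_or_ge d 6 with hd | hd
  · exact hodgeConjectureFor_of_isSmoothHypersurface_four_of_le_five (by omega) hX
  · exact h hd hX

/-- **… indeed it is the algebraicity of rational `(2,2)`-classes on smooth hypersurface fourfolds of
degree `≥ 6`** (the honest open residue: `HC` for all smooth hypersurface fourfolds iff every rational
`(2,2)`-class on every smooth hypersurface fourfold of degree `d ≥ 6` is algebraic).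
[cite: VoisinHodgeII2003, Cor. 1.24–1.25 and Prop. 10.26] [cite: ConteMurre1978] -/
theorem forall_hodgeConjectureFor_isSmoothHypersurface_four_iff_twoTwo_six_le :
    (∀ ⦃d : ℕ⦄ ⦃X : SchemeOver ℂ⦄, IsSmoothHypersurface 4 d X → HodgeConjectureFor 4 X) ↔
      ∀ ⦃d : ℕ⦄ ⦃X : SchemeOver ℂ⦄, 6 ≤ d → IsSmoothHypersurface 4 d X →
        ∀ c : complexBetti X (2 * 2), IsRationalClass c → IsOfHodgeType 4 X (2 * 2) 2 2 c →
          c ∈ algebraicClasses X 2 := by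
  rw [forall_hodgeConjectureFor_isSmoothHypersurface_four_iff_six_le]
  exact ⟨fun h d X hd hX ↦ twoTwo_of_hodgeConjectureFor_four (h hd hX),
    fun h d X hd hX ↦ hodgeConjectureFor_four_of_isSmoothHypersurface_of_twoTwo hX (h hd hX)⟩

end Literature.AlgebraicGeometry.HodgeTheory

end
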